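import Literature.NumberTheory.EllipticCurves.HaberlandBoundaryProofs
import HarnessLib

/-!
# Haberland's formula for cusp forms on `Γ₀(N)` (Paşol–Popa Thm. 3.2(a)): the group-ring algebra
# of §8.2 and the final formula `6(2i)ⁿ⁺¹ (g, f) = ∑_A ⟨ρ_f|(T⁻¹ - T)(A), \overline{ρ_g(A)}⟩`

Theorems only (no definitions, no named facts). Last brick of the proof of **Haberland's formula**
(V. Paşol, A. A. Popa, *Modular forms and period polynomials*, Proc. LMS 107 (2013), Thm. 3.2(a):
`6 C_k (f,g) = {ρ_f, ρ̄_g} = ⟨⟨ρ_f|(T - T⁻¹), ρ̄_g⟩⟩`, `C_k = -(2i)^{k-1}`; proved there (and here)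
through the proof of Thm. 8.6 in §8.2 on the standard fundamental domain). The analytic part is
`HaberlandBoundary.two_mul_petersson_eq_sum_invForm` (PP (7.11) for cusp forms,
`2(2i)ⁿ⁺¹ (g,f) = ∑_A ⟨ρ_f(A), \overline{H_{ρ²}(A) - H_ρ(A)}⟩`); this file supplies the algebra
that follows (7.11) in §8.2, in the tree's moment coordinates (`ρ_f(A) ↔ msymbMoment n A · f`,
`H_{z₀}(A) ↔ momVec (g∣A) z₀`, `P|T ↔ σ_T' = twistPinv`, `P|T⁻¹ ↔ σ_T = twistP`, `P|S ↔ σ_S`,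
`P|U ↔ σ_U⁻¹`, `⟨·,·⟩ ↔ invForm`):

* `HaberlandAlgebra.invForm_twistP/twistPinv/twistS/twistU` — `SL₂(ℤ)`-invariance of the
  pairing (3.3) (by polarising the tree's `invForm_eq_of_momPoly_mulVec`);
* `HaberlandAlgebra.momVec_rho2_eq` — (8.12) `H_{ρ²} = H_ρ|T` (`Tρ² = ρ`);
  `HaberlandAlgebra.msymbMoment_eq_momVec_rho` — (8.12) `ρ_g = H_ρ - H_{ρ²}|S` (`Sρ² = ρ`; the
  cocycle identities `periodFn_eq`, `momPoly_msymbMoment` at the base points `ρ, ρ²`);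
* `HaberlandAlgebra.haberland_algebra` — for even `n`:
  `3 ∑ᵢ ⟨ρ_f(Aᵢ), \overline{H_{ρ²} - H_ρ}(Aᵢ)⟩ = ∑ᵢ ⟨σ_T ρ_f(AᵢT) - σ_T' ρ_f(AᵢT⁻¹), ρ̄_g(Aᵢ)⟩`
  over any family `A` of matrices over which left-`Γ₀(N)`-invariant functions can be re-indexed
  by right translations: PP's chain `2C_k(f,g) = ⟨⟨ρ_f, H̄_ρ|(1-T)⟩⟩ = … = ⅓⟨⟨ρ_f|(T-T⁻¹), ρ̄_g⟩⟩`
  (period relations `ρ_f|(1+S) = 0`, `ρ_f|(1+U+U²) = 0` = `msymbMoment_two_term/three_term`,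
  invariance of the pairing), organised through the three sums `a = ⟨⟨ρ_f, H̄_ρ⟩⟩`,
  `b = ⟨⟨ρ_f|U⁻¹, H̄_ρ⟩⟩`, `c = ⟨⟨ρ_f|U, H̄_ρ⟩⟩` with `a + b + c = 0`;
* **`HaberlandAlgebra.six_mul_petersson_eq_sum_invForm`** — Haberland's formula for
  `f, g ∈ S_{n+2}(Γ₀(N))`, `n` even, over a system `g_q` of coset representatives:
  `6 (2i)ⁿ⁺¹ · peterssonProduct Γ₀(N) (n+2) g f
     = ∑_q invForm (σ_T μ_f(g_q⁻¹T) - σ_T' μ_f(g_q⁻¹T⁻¹)) (\overline{μ_g(g_q⁻¹)})`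
  — PP Thm. 3.2(a) `-6(2i)^{k-1}(f,g) = ⟨⟨ρ_f|(T-T⁻¹), ρ̄_g⟩⟩` in the tree's normalisation
  (`peterssonProduct` antilinear in the first variable, `= C_Γ (f,g)_{PP}`);
  **`HaberlandAlgebra.six_mul_petersson_eq_sum_coset`** — the same indexed by the cosets
  `x ∈ SL₂(ℤ)/Γ₀(N)` with the tree's M-symbol vectors `msymbK n x · f`:
  `6 (2i)ⁿ⁺¹ (g, f) = ∑_x invForm (σ_T R_f(T⁻¹x) - σ_T' R_f(Tx)) (\overline{R_g(x)})`.

## References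

* [PasolPopa2013] V. Paşol, A. A. Popa, Proc. LMS 107 (2013) 713–743, arXiv:1202.5802: Thm. 3.2,
  (3.3), §8.2 (proof of Thm. 8.6, (7.11), (8.12)).
-/

noncomputable section

open MeasureTheory Set Filter Topology Complex
open scoped ComplexConjugate UpperHalfPlane MatrixGroups ModularForm

namespace Literature.NumberTheory.EllipticCurves.ModularForms

namespace HaberlandAlgebra


open UpperHalfPlane hiding I
open ModularGroup CongruenceSubgroup

variable {N : ℕ} [NeZero N] {n : ℕ}

/-! ### Invariance of `invForm` under the twists -/

/-- Polarisation: a twist preserving the quadratic form `invForm y y` preserves the bilinear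
form (even `n`). [folklore] -/
theorem invForm_mulVec_mulVec_of_sq (hn : Even n) (W : Matrix (Fin (n + 1)) (Fin (n + 1)) ℂ)
    (hW : ∀ y : Fin (n + 1) → ℂ, invForm n (W.mulVec y) (W.mulVec y) = invForm n y y)
    (x y : Fin (n + 1) → ℂ) : invForm n (W.mulVec x) (W.mulVec y) = invForm n x y := by
  have h := hW (x + y)
  rw [Matrix.mulVec_add] at h
  simp only [map_add, LinearMap.add_apply] at h
  rw [hW x, hW y, invForm_comm hn (W.mulVec y), invForm_comm hn y x] at h
  linear_combination (1 / 2 : ℂ) * h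

/-- `invForm (σ_T x) (σ_T y) = invForm x y`. [folklore] -/
theorem invForm_twistP (hn : Even n) (x y : Fin (n + 1) → ℂ) :
    invForm n ((twistP n).mulVec x) ((twistP n).mulVec y) = invForm n x y := by
  refine invForm_mulVec_mulVec_of_sq hn _ (fun z ↦ ?_) x y
  refine invForm_eq_of_momPoly_mulVec hn !![1, -1; 0, 1] (by simp) fun p ↦ ?_
  rw [momPoly_twistP_mulVec]
  have hv : (!![1, -1; 0, 1] : Matrix (Fin 2) (Fin 2) ℂ).mulVec p = ![p 0 - p 1, p 1] := by
    funext i; fin_cases i <;> simp [Matrix.mulVec, dotProduct, Fin.sum_univ_two, sub_eq_add_neg]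
  rw [hv]

/-- `invForm (σ_T' x) (σ_T' y) = invForm x y`. [folklore] -/
theorem invForm_twistPinv (hn : Even n) (x y : Fin (n + 1) → ℂ) :
    invForm n ((twistPinv n).mulVec x) ((twistPinv n).mulVec y) = invForm n x y := by
  refine invForm_mulVec_mulVec_of_sq hn _ (fun z ↦ ?_) x y
  refine invForm_eq_of_momPoly_mulVec hn !![1, 1; 0, 1] (by simp) fun p ↦ ?_
  rw [momPoly_twistPinv_mulVec]
  have hv : (!![1, 1; 0, 1] : Matrix (Fin 2) (Fin 2) ℂ).mulVec p = ![p 0 + p 1, p 1] := by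
    funext i; fin_cases i <;> simp [Matrix.mulVec, dotProduct, Fin.sum_univ_two]
  rw [hv]

/-- `invForm (σ_S x) (σ_S y) = invForm x y`. [folklore] -/
theorem invForm_twistS (hn : Even n) (x y : Fin (n + 1) → ℂ) :
    invForm n ((twistS n).mulVec x) ((twistS n).mulVec y) = invForm n x y := by
  refine invForm_mulVec_mulVec_of_sq hn _ (fun z ↦ ?_) x y
  refine invForm_eq_of_momPoly_mulVec hn !![0, 1; -1, 0] (by simp) fun p ↦ ?_
  rw [momPoly_twistS_mulVec]
  have hv : (!![0, 1; -1, 0] : Matrix (Fin 2) (Fin 2) ℂ).mulVec p = ![p 1, -p 0] := by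
    funext i; fin_cases i <;> simp [Matrix.mulVec, dotProduct, Fin.sum_univ_two]
  rw [hv]

/-! ### The points `ρ = ½ + i√3/2` and `ρ² = -½ + i√3/2` -/

/-- `T ρ² = ρ`. [folklore] -/
theorem T_smul_rho2 :
    T • ofComplex ((((-(1 / 2) : ℝ)) : ℂ) + Real.sqrt (1 - (-(1 / 2) : ℝ) ^ 2) * I) =
      ofComplex ((((1 / 2 : ℝ)) : ℂ) + Real.sqrt (1 - (1 / 2 : ℝ) ^ 2) * I) := by
  have hw : (0 : ℝ) < Real.sqrt (1 - (1 / 2 : ℝ) ^ 2) := Real.sqrt_pos.mpr (by norm_num)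
  have h1 : 0 < ((((-(1 / 2) : ℝ)) : ℂ) + Real.sqrt (1 - (-(1 / 2) : ℝ) ^ 2) * I).im := by
    rw [neg_sq]; simpa using hw
  have h2 : 0 < ((((1 / 2 : ℝ)) : ℂ) + Real.sqrt (1 - (1 / 2 : ℝ) ^ 2) * I).im := by simpa using hw
  apply UpperHalfPlane.ext
  rw [modular_T_smul, coe_vadd, ofComplex_apply_of_im_pos h1, ofComplex_apply_of_im_pos h2, coe_mk, coe_mk,
    neg_sq]
  push_cast
  ring

/-- General `T`-law: `∫_τ^{i∞}(f∣AT)(t)(tv-u)ⁿdt = ∫_{Tτ}^{i∞}(f∣A)(t)(tv'-u')ⁿdt`, `(u',v') = T(u,v)`. [folklore] -/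
theorem eichlerKernel_mul_T (f : CuspForm (Gamma0 N) (n + 2)) (A : SL(2, ℤ)) (τ : ℍ) (p : Fin 2 → ℂ) :
    eichlerKernel n (⇑f ∣[(n + 2 : ℤ)] (A * T)) τ p =
      eichlerKernel n (⇑f ∣[(n + 2 : ℤ)] A) (T • τ) ((icmat T).mulVec p) := by
  have hφ : IsCuspFunction N (⇑f ∣[(n + 2 : ℤ)] A) := isCuspFunction_slash f A
  have hψ : IsCuspFunction N ((⇑f ∣[(n + 2 : ℤ)] A) ∣[(n + 2 : ℤ)] (T : GL (Fin 2) ℝ)) := by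
    rw [← ModularForm.SL_slash, ← SlashAction.slash_mul]; exact isCuspFunction_slash f (A * T)
  have hT : ((T : GL (Fin 2) ℝ) : Matrix (Fin 2) (Fin 2) ℝ) 1 0 = 0 := by simp [coe_T]
  have h := hφ.eichlerKernel_slash_eq_of_apply_one_zero (n := n) (det_coe_pos T) hT hψ p τ
  rw [← ModularForm.SL_slash, ← SlashAction.slash_mul, cmat_coe] at h
  exact h

/-- **`H_{ρ²}(A) = σ_T' H_ρ(AT⁻¹)`**, i.e. PP's `H_{ρ²} = H_ρ|T` for cusp forms:
`∫_{ρ²}^{i∞} (g∣A) tʲ dt` in terms of `∫_ρ^{i∞} (g∣AT⁻¹)`. [cite: PasolPopa2013, §8.2 (8.12)] -/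
theorem momVec_rho2_eq (hn : Even n) (G : CuspForm (Gamma0 N) (n + 2)) (A : SL(2, ℤ)) :
    momVec n (⇑G ∣[(n + 2 : ℤ)] A)
        (ofComplex ((((-(1 / 2) : ℝ)) : ℂ) + Real.sqrt (1 - (-(1 / 2) : ℝ) ^ 2) * I)) =
      (twistPinv n).mulVec (momVec n (⇑G ∣[(n + 2 : ℤ)] (A * T⁻¹))
        (ofComplex ((((1 / 2 : ℝ)) : ℂ) + Real.sqrt (1 - (1 / 2 : ℝ) ^ 2) * I))) := by
  refine eq_of_momPoly_eq hn fun p ↦ ?_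
  rw [momPoly_twistPinv_mulVec, ← eichlerKernel_eq_momPoly, ← eichlerKernel_eq_momPoly,
    ← T_smul_rho2]
  have h := eichlerKernel_mul_T G (A * T⁻¹) 
    (ofComplex ((((-(1 / 2) : ℝ)) : ℂ) + Real.sqrt (1 - (-(1 / 2) : ℝ) ^ 2) * I)) p
  rw [inv_mul_cancel_right] at h
  rw [h]
  congr 1
  funext i; fin_cases i <;> simp [Matrix.mulVec, dotProduct, Fin.sum_univ_two, coe_T]

/-- `S ρ² = ρ`. [folklore] -/
theorem S_smul_rho2 :
    S • ofComplex ((((-(1 / 2) : ℝ)) : ℂ) + Real.sqrt (1 - (-(1 / 2) : ℝ) ^ 2) * I) =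
      ofComplex ((((1 / 2 : ℝ)) : ℂ) + Real.sqrt (1 - (1 / 2 : ℝ) ^ 2) * I) := by
  have hw2 : Real.sqrt (1 - (1 / 2 : ℝ) ^ 2) ^ 2 = 3 / 4 := by
    rw [Real.sq_sqrt (by norm_num)]; norm_num
  have hw : (0 : ℝ) < Real.sqrt (1 - (1 / 2 : ℝ) ^ 2) := Real.sqrt_pos.mpr (by norm_num)
  have h1 : 0 < ((((-(1 / 2) : ℝ)) : ℂ) + Real.sqrt (1 - (-(1 / 2) : ℝ) ^ 2) * I).im := by
    rw [neg_sq]; simpa using hw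
  have h2 : 0 < ((((1 / 2 : ℝ)) : ℂ) + Real.sqrt (1 - (1 / 2 : ℝ) ^ 2) * I).im := by simpa using hw
  apply UpperHalfPlane.ext
  rw [modular_S_smul, coe_mk, ofComplex_apply_of_im_pos h1, ofComplex_apply_of_im_pos h2, coe_mk, coe_mk,
    neg_sq]
  set w : ℝ := Real.sqrt (1 - (1 / 2 : ℝ) ^ 2) with hw'
  -- `-(−1/2 + iw)⁻¹ = 1/2 + iw` since `|−1/2 + iw| = 1`
  have hnorm : ((((-(1 / 2) : ℝ)) : ℂ) + w * I) * ((((1 / 2 : ℝ)) : ℂ) + w * I) = -1 := by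
    have hwC : (w : ℂ) ^ 2 = 3 / 4 := by rw [← Complex.ofReal_pow, hw2]; norm_num
    push_cast
    linear_combination (-1 : ℂ) * hwC + ((w : ℂ) ^ 2) * Complex.I_sq
  have hone : ((((-(1 / 2) : ℝ)) : ℂ) + w * I) * (-((((1 / 2 : ℝ)) : ℂ) + w * I)) = 1 := by
    linear_combination (-1 : ℂ) * hnorm
  rw [inv_neg, inv_eq_of_mul_eq_one_right hone, neg_neg]

/-- **`ρ_g(A) = H_ρ(A) - σ_S H_{ρ²}(AS)`**, i.e. PP's `ρ_g = H_ρ - H_{ρ²}|S` for cusp forms: the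
transformation law at `S` between the base points `ρ²` and `ρ = Sρ²`, in moment coordinates. [cite: PasolPopa2013, §8.2 (8.12)] -/
theorem msymbMoment_eq_momVec_rho (hn : Even n) (G : CuspForm (Gamma0 N) (n + 2)) (A : SL(2, ℤ)) :
    (fun j ↦ msymbMoment n A j G) =
      momVec n (⇑G ∣[(n + 2 : ℤ)] A) (ofComplex ((((1 / 2 : ℝ)) : ℂ) + Real.sqrt (1 - (1 / 2 : ℝ) ^ 2) * I)) -
        (twistS n).mulVec (momVec n (⇑G ∣[(n + 2 : ℤ)] (A * S))
          (ofComplex ((((-(1 / 2) : ℝ)) : ℂ) + Real.sqrt (1 - (-(1 / 2) : ℝ) ^ 2) * I))) := by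
  set ρ₂ : ℍ := ofComplex ((((-(1 / 2) : ℝ)) : ℂ) + Real.sqrt (1 - (-(1 / 2) : ℝ) ^ 2) * I) with hρ₂
  set ρ₁ : ℍ := ofComplex ((((1 / 2 : ℝ)) : ℂ) + Real.sqrt (1 - (1 / 2 : ℝ) ^ 2) * I) with hρ₁
  have hS : S • ρ₂ = ρ₁ := S_smul_rho2
  refine eq_of_momPoly_eq hn fun p ↦ ?_
  rw [map_sub, Pi.sub_apply, momPoly_twistS_mulVec, ← eichlerKernel_eq_momPoly, ← eichlerKernel_eq_momPoly,
    momPoly_msymbMoment, periodFn_eq G A p ρ₁, periodFn_eq G (A * S) _ ρ₂, mul_smul, hS]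
  have hAS : (icmat (A * S)).mulVec ![p 1, -p 0] = (icmat A).mulVec p := by
    rw [icmat_mul, ← Matrix.mulVec_mulVec, icmat_S_mulVec]
  rw [hAS]
  ring

/-! ### Conjugation commutes with the (real) twists -/

/-- `conj (σ_S y) = σ_S (conj y)`. [folklore] -/
theorem conj_twistS_mulVec (y : Fin (n + 1) → ℂ) :
    (fun j ↦ conj ((twistS n).mulVec y j)) = (twistS n).mulVec (fun j ↦ conj (y j)) := by
  funext j
  rw [twistS_mulVec, twistS_mulVec, map_mul, map_pow, map_neg, map_one]

/-- `conj (σ_T y) = σ_T (conj y)`. [folklore] -/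
theorem conj_twistP_mulVec (y : Fin (n + 1) → ℂ) :
    (fun j ↦ conj ((twistP n).mulVec y j)) = (twistP n).mulVec (fun j ↦ conj (y j)) := by
  funext j
  rw [twistP_mulVec, twistP_mulVec, map_sum]
  refine Finset.sum_congr rfl fun i _ ↦ ?_
  rw [map_mul]
  congr 1
  split_ifs <;> simp

/-- `conj (σ_T' y) = σ_T' (conj y)`. [folklore] -/
theorem conj_twistPinv_mulVec (y : Fin (n + 1) → ℂ) :
    (fun j ↦ conj ((twistPinv n).mulVec y j)) = (twistPinv n).mulVec (fun j ↦ conj (y j)) := by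
  funext j
  rw [twistPinv_mulVec, twistPinv_mulVec, map_sum]
  refine Finset.sum_congr rfl fun i _ ↦ ?_
  rw [map_mul]
  congr 1
  split_ifs <;> simp

/-- `conj (σ_U y) = σ_U (conj y)`. [folklore] -/
theorem conj_twistU_mulVec (y : Fin (n + 1) → ℂ) :
    (fun j ↦ conj ((twistU n).mulVec y j)) = (twistU n).mulVec (fun j ↦ conj (y j)) := by
  rw [twistU, ← Matrix.mulVec_mulVec, ← Matrix.mulVec_mulVec, ← conj_twistS_mulVec, ← conj_twistP_mulVec]

/-- `invForm (σ_U x) (σ_U y) = invForm x y`. [folklore] -/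
theorem invForm_twistU (hn : Even n) (x y : Fin (n + 1) → ℂ) :
    invForm n ((twistU n).mulVec x) ((twistU n).mulVec y) = invForm n x y := by
  rw [twistU, ← Matrix.mulVec_mulVec, ← Matrix.mulVec_mulVec, invForm_twistP hn, invForm_twistS hn]

/-! ### The algebra of Paşol–Popa §8.2: from `⟨ρ_f, H̄_{ρ²} - H̄_ρ⟩` to `⟨ρ_f|(T⁻¹-T), ρ̄_g⟩` -/

omit [NeZero N] in
/-- `-1 ∈ Γ₀(N)`. [folklore] -/
theorem neg_one_mem_Gamma0 : (-1 : SL(2, ℤ)) ∈ Gamma0 N := by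
  simp [Gamma0_mem]

omit [NeZero N] in
/-- Left `Γ₀(N)`-invariance of `B ↦ momVec (G ∣ B) z`. [folklore] -/
theorem momVec_gamma0_mul (G : CuspForm (Gamma0 N) (n + 2)) {γ : SL(2, ℤ)} (hγ : γ ∈ Gamma0 N)
    (B : SL(2, ℤ)) (z : ℍ) : momVec n (⇑G ∣[(n + 2 : ℤ)] (γ * B)) z = momVec n (⇑G ∣[(n + 2 : ℤ)] B) z := by
  rw [SlashAction.slash_mul, slash_gamma0_eq_self G ⟨γ, hγ⟩]

/-- **The group-ring algebra of Haberland's formula** (Paşol–Popa §8.2, from (7.11) to Thm. 3.2(a),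
for cusp forms): for even `n`, any finite family `A` of matrices over which left-`Γ₀(N)`-invariant
functions can be re-indexed by right translations (e.g. a system of representatives of
`Γ₀(N)\SL₂(ℤ)`), and cusp forms `f, g`,
`3 ∑ᵢ ⟨ρ_f(Aᵢ), \overline{H_{ρ²}(Aᵢ) - H_ρ(Aᵢ)}⟩ = ∑ᵢ ⟨σ_T ρ_f(AᵢT) - σ_T' ρ_f(AᵢT⁻¹), \overline{ρ_g(Aᵢ)}⟩`
(the relations `ρ_f|(1+S) = 0`, `ρ_f|(1+U+U²) = 0`, `H_{ρ²} = H_ρ|T`, `ρ_g = H_ρ|(1-TS)` and the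
`Γ₁`-invariance of the pairing). [cite: PasolPopa2013, §8.2 (proof of Thm. 8.6(a))] -/
theorem haberland_algebra (hn : Even n) {ι : Type*} [Fintype ι] (A : ι → SL(2, ℤ))
    (hre : ∀ F : SL(2, ℤ) → ℂ, (∀ γ : SL(2, ℤ), γ ∈ Gamma0 N → ∀ B, F (γ * B) = F B) →
      ∀ s : SL(2, ℤ), ∑ i, F (A i * s) = ∑ i, F (A i))
    (f G : CuspForm (Gamma0 N) (n + 2)) :
    3 * ∑ i, invForm n (fun j ↦ msymbMoment n (A i) j f) (fun j ↦ conj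
        (momVec n (⇑G ∣[(n + 2 : ℤ)] (A i))
            (ofComplex ((((-(1 / 2) : ℝ)) : ℂ) + Real.sqrt (1 - (-(1 / 2) : ℝ) ^ 2) * I)) j -
          momVec n (⇑G ∣[(n + 2 : ℤ)] (A i))
            (ofComplex ((((1 / 2 : ℝ)) : ℂ) + Real.sqrt (1 - (1 / 2 : ℝ) ^ 2) * I)) j)) =
      ∑ i, invForm n ((twistP n).mulVec (fun j ↦ msymbMoment n (A i * T) j f) -
          (twistPinv n).mulVec (fun j ↦ msymbMoment n (A i * T⁻¹) j f))
        (fun j ↦ conj (msymbMoment n (A i) j G)) := by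
  -- notation
  set ρ₂ : ℍ := ofComplex ((((-(1 / 2) : ℝ)) : ℂ) + Real.sqrt (1 - (-(1 / 2) : ℝ) ^ 2) * I) with hρ₂
  set ρ₁ : ℍ := ofComplex ((((1 / 2 : ℝ)) : ℂ) + Real.sqrt (1 - (1 / 2 : ℝ) ^ 2) * I) with hρ₁
  set Rf : SL(2, ℤ) → Fin (n + 1) → ℂ := fun B j ↦ msymbMoment n B j f with hRf
  set RG : SL(2, ℤ) → Fin (n + 1) → ℂ := fun B j ↦ conj (msymbMoment n B j G) with hRG
  set X : SL(2, ℤ) → Fin (n + 1) → ℂ := fun B j ↦ conj (momVec n (⇑G ∣[(n + 2 : ℤ)] B) ρ₁ j) with hX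
  -- invariances
  have hRf_inv : ∀ γ : SL(2, ℤ), γ ∈ Gamma0 N → ∀ B, Rf (γ * B) = Rf B := fun γ hγ B ↦ by
    funext j; exact congrArg (fun φ ↦ φ f) (msymbMoment_gamma0_mul n hγ B j)
  have hRG_inv : ∀ γ : SL(2, ℤ), γ ∈ Gamma0 N → ∀ B, RG (γ * B) = RG B := fun γ hγ B ↦ by
    funext j; simp only [hRG]; rw [msymbMoment_gamma0_mul n hγ B j]
  have hX_inv : ∀ γ : SL(2, ℤ), γ ∈ Gamma0 N → ∀ B, X (γ * B) = X B := fun γ hγ B ↦ by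
    funext j; simp only [hX]; rw [momVec_gamma0_mul G hγ]
  have hRf_neg : ∀ B, Rf (-B) = Rf B := fun B ↦ by
    rw [show -B = (-1 : SL(2, ℤ)) * B by simp, hRf_inv _ neg_one_mem_Gamma0]
  have hX_neg : ∀ B, X (-B) = X B := fun B ↦ by
    rw [show -B = (-1 : SL(2, ℤ)) * B by simp, hX_inv _ neg_one_mem_Gamma0]
  -- (ii') `conj H_{ρ²}(B) = σ_T' X(B T⁻¹)`
  have hH2 : ∀ B, (fun j ↦ conj (momVec n (⇑G ∣[(n + 2 : ℤ)] B) ρ₂ j)) = (twistPinv n).mulVec (X (B * T⁻¹)) := by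
    intro B
    rw [hρ₂, momVec_rho2_eq hn G B, ← conj_twistPinv_mulVec]
  -- (iii') `RG(B) = X(B) - σ_U² X(B S T⁻¹)`
  have hRG_eq : ∀ B, RG B = X B - (twistU n).mulVec ((twistU n).mulVec (X (B * S * T⁻¹))) := by
    intro B
    have h := msymbMoment_eq_momVec_rho hn G B
    rw [Matrix.mulVec_mulVec, twistU_mul_twistU hn, ← Matrix.mulVec_mulVec, ← hH2 (B * S),
      ← conj_twistS_mulVec]
    funext j
    have hj := congrFun h j
    simp only [Pi.sub_apply] at hj
    simp only [hRG, hX, Pi.sub_apply]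
    rw [hj, map_sub]
  -- (E1) `σ_T Rf(B T) = -σ_U Rf(B T S)`
  have hE1 : ∀ B, (twistP n).mulVec (Rf (B * T)) = -(twistU n).mulVec (Rf (B * T * S)) := by
    intro B
    have h2 := msymbMoment_two_term n hn (B * T) f
    rw [twistU, ← Matrix.mulVec_mulVec, ← Matrix.mulVec_neg]
    congr 1
    rw [eq_neg_iff_add_eq_zero]
    exact h2
  -- two-term for `G`, conjugated: `RG(B) + σ_S RG(B S) = 0`
  have h2G : ∀ B, RG B + (twistS n).mulVec (RG (B * S)) = 0 := by
    intro B
    have h2 := msymbMoment_two_term n hn B G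
    have : RG (B * S) = fun j ↦ conj (msymbMoment n (B * S) j G) := rfl
    rw [this, ← conj_twistS_mulVec]
    funext j
    have := congrFun h2 j
    simp only [Pi.add_apply, Pi.zero_apply] at this
    simp only [hRG, Pi.add_apply, Pi.zero_apply, ← map_add, this, map_zero]
  -- three-term for `f`
  have h3f : ∀ B, Rf B + (twistU n).mulVec (Rf (B * (T * S))) +
      (twistU n).mulVec ((twistU n).mulVec (Rf (B * (T * S) * (T * S)))) = 0 := fun B ↦
    msymbMoment_three_term n hn B f
  -- the three sums
  set a : ℂ := ∑ i, invForm n (Rf (A i)) (X (A i)) with ha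
  set b : ℂ := ∑ i, invForm n ((twistU n).mulVec (Rf (A i * (T * S)))) (X (A i)) with hb
  set c : ℂ := ∑ i, invForm n ((twistU n).mulVec ((twistU n).mulVec (Rf (A i * (T * S) * (T * S))))) (X (A i))
    with hc
  have hR1 : a + b + c = 0 := by
    rw [ha, hb, hc, ← Finset.sum_add_distrib, ← Finset.sum_add_distrib]
    refine Finset.sum_eq_zero fun i _ ↦ ?_
    rw [← LinearMap.add_apply, ← LinearMap.add_apply, ← map_add, ← map_add, h3f, map_zero,
      LinearMap.zero_apply]
  -- group identities
  have hTSS : ∀ B : SL(2, ℤ), B * (T * S) * S * T⁻¹ = -B := fun B ↦ by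
    rw [mul_assoc B, TS_mul_S, mul_neg, neg_mul, mul_inv_cancel_right]
  have hTSTS : ∀ B : SL(2, ℤ), B * (T * S) * (T * S) = B * S * T⁻¹ := fun B ↦ by
    rw [mul_assoc B, TS_mul_TS, mul_assoc]
  have hU3 : ∀ v : Fin (n + 1) → ℂ, (twistU n).mulVec ((twistU n).mulVec ((twistU n).mulVec v)) = v := by
    intro v
    rw [Matrix.mulVec_mulVec, Matrix.mulVec_mulVec, ← pow_three', twistU_pow_three hn,
      Matrix.one_mulVec]
  have hPinv : ∀ v : Fin (n + 1) → ℂ, (twistPinv n).mulVec v =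
      (twistS n).mulVec ((twistU n).mulVec ((twistU n).mulVec v)) := by
    intro v
    rw [Matrix.mulVec_mulVec, Matrix.mulVec_mulVec, mul_assoc, twistU_mul_twistU hn, ← mul_assoc,
      twistS_mul_twistS hn, one_mul]
  -- `Y = c`
  have hY : ∑ i, invForm n (Rf (A i)) (fun j ↦ conj (momVec n (⇑G ∣[(n + 2 : ℤ)] (A i)) ρ₂ j -
      momVec n (⇑G ∣[(n + 2 : ℤ)] (A i)) ρ₁ j)) = c := by
    have h1 : ∀ i, invForm n (Rf (A i)) (fun j ↦ conj (momVec n (⇑G ∣[(n + 2 : ℤ)] (A i)) ρ₂ j -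
        momVec n (⇑G ∣[(n + 2 : ℤ)] (A i)) ρ₁ j)) =
        invForm n (Rf (A i)) ((twistPinv n).mulVec (X (A i * T⁻¹))) - invForm n (Rf (A i)) (X (A i)) := by
      intro i
      rw [← map_sub (invForm n (Rf (A i))), ← hH2]
      congr 1
      funext j
      simp only [Pi.sub_apply, map_sub, hX]
    simp_rw [h1]
    rw [Finset.sum_sub_distrib]
    have h2 := hre (fun B ↦ invForm n (Rf B) ((twistPinv n).mulVec (X (B * T⁻¹)))) (fun γ hγ B ↦ by
      simp only [hRf_inv γ hγ, mul_assoc, hX_inv γ hγ]) T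
    simp only [mul_inv_cancel_right] at h2
    rw [← h2]
    have h3 : ∀ i, invForm n (Rf (A i * T)) ((twistPinv n).mulVec (X (A i))) =
        -invForm n ((twistU n).mulVec (Rf (A i * (T * S)))) (X (A i)) := by
      intro i
      rw [← invForm_twistP hn, Matrix.mulVec_mulVec, twistP_mul_twistPinv hn, Matrix.one_mulVec, hE1,
        map_neg, LinearMap.neg_apply, mul_assoc]
    simp_rw [h3]
    rw [Finset.sum_neg_distrib, ← hb, ← ha]
    linear_combination (-1 : ℂ) * hR1
  -- `D1 = -b + c`
  have hD1 : ∑ i, invForm n ((twistP n).mulVec (Rf (A i * T))) (RG (A i)) = -b + c := by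
    have h1 : ∀ i, invForm n ((twistP n).mulVec (Rf (A i * T))) (RG (A i)) =
        -invForm n ((twistU n).mulVec (Rf (A i * (T * S)))) (X (A i)) +
          invForm n ((twistU n).mulVec (Rf (A i * (T * S))))
            ((twistU n).mulVec ((twistU n).mulVec (X (A i * S * T⁻¹)))) := by
      intro i
      rw [hE1, hRG_eq, map_neg, LinearMap.neg_apply, map_sub, mul_assoc]
      ring
    simp_rw [h1]
    rw [Finset.sum_add_distrib, Finset.sum_neg_distrib, ← hb]
    congr 1
    -- `c₁ = c`
    have h2 := hre (fun B ↦ invForm n ((twistU n).mulVec (Rf (B * (T * S))))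
      ((twistU n).mulVec ((twistU n).mulVec (X (B * S * T⁻¹))))) (fun γ hγ B ↦ by
      simp only [mul_assoc, hRf_inv γ hγ, hX_inv γ hγ]) (T * S)
    rw [← h2, hc]
    refine Finset.sum_congr rfl fun i _ ↦ ?_
    rw [hTSS, hX_neg, ← invForm_twistU hn, hU3]
  -- `D2 = a - c`
  have hD2 : ∑ i, invForm n ((twistPinv n).mulVec (Rf (A i * T⁻¹))) (RG (A i)) = a - c := by
    have h1 : ∀ i, invForm n ((twistPinv n).mulVec (Rf (A i * T⁻¹))) (RG (A i)) =
        -invForm n ((twistU n).mulVec ((twistU n).mulVec (Rf (A i * S⁻¹ * S * T⁻¹)))) (RG (A i * S⁻¹)) := by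
      intro i
      have hS2 := h2G (A i * S⁻¹)
      rw [inv_mul_cancel_right] at hS2
      have hS2' : (twistS n).mulVec (RG (A i)) = -RG (A i * S⁻¹) := eq_neg_of_add_eq_zero_right hS2
      rw [hPinv, ← invForm_twistS hn, Matrix.mulVec_mulVec, twistS_mul_twistS hn, Matrix.one_mulVec,
        hS2', map_neg, inv_mul_cancel_right]
    simp_rw [h1]
    rw [Finset.sum_neg_distrib]
    have h2 := hre (fun B ↦ invForm n ((twistU n).mulVec ((twistU n).mulVec (Rf (B * S * T⁻¹)))) (RG B))
      (fun γ hγ B ↦ by simp only [mul_assoc, hRf_inv γ hγ, hRG_inv γ hγ]) S⁻¹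
    rw [h2]
    have h3 : ∀ i, invForm n ((twistU n).mulVec ((twistU n).mulVec (Rf (A i * S * T⁻¹)))) (RG (A i)) =
        invForm n ((twistU n).mulVec ((twistU n).mulVec (Rf (A i * (T * S) * (T * S))))) (X (A i)) -
          invForm n (Rf (A i * (S * T⁻¹))) (X (A i * (S * T⁻¹))) := by
      intro i
      rw [hRG_eq, map_sub, hTSTS, ← mul_assoc, invForm_twistU hn, invForm_twistU hn]
    simp_rw [h3]
    rw [Finset.sum_sub_distrib, ← hc, hre (fun B ↦ invForm n (Rf B) (X B))
      (fun γ hγ B ↦ by simp only [hRf_inv γ hγ, hX_inv γ hγ]) (S * T⁻¹), ← ha]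
    ring
  -- conclusion
  change 3 * _ = ∑ i, invForm n ((twistP n).mulVec (Rf (A i * T)) -
    (twistPinv n).mulVec (Rf (A i * T⁻¹))) (RG (A i))
  rw [hY]
  have h4 : ∀ i, invForm n ((twistP n).mulVec (Rf (A i * T)) - (twistPinv n).mulVec (Rf (A i * T⁻¹))) (RG (A i)) =
      invForm n ((twistP n).mulVec (Rf (A i * T))) (RG (A i)) -
        invForm n ((twistPinv n).mulVec (Rf (A i * T⁻¹))) (RG (A i)) := by
    intro i
    rw [map_sub, LinearMap.sub_apply]
  simp_rw [h4]
  rw [Finset.sum_sub_distrib, hD1, hD2]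
  linear_combination hR1


/-! ### Haberland's formula -/

section Formula

variable (g : (↥𝒮ℒ ⧸ (Gamma0 N : Subgroup (GL (Fin 2) ℝ)).subgroupOf 𝒮ℒ) → SL(2, ℤ))
  (hg : ∀ q, (Matrix.SpecialLinearGroup.mapGL ℝ (g q) : GL (Fin 2) ℝ) = ((q.out : ↥𝒮ℒ) : GL (Fin 2) ℝ))

include hg in
omit [NeZero N] in
/-- Re-indexing of left-`Γ₀(N)`-invariant functions over the representatives `g_q⁻¹` by right
translation. [folklore] -/
theorem sum_rep_inv_mul [Fintype (↥𝒮ℒ ⧸ (Gamma0 N : Subgroup (GL (Fin 2) ℝ)).subgroupOf 𝒮ℒ)]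
    (F : SL(2, ℤ) → ℂ) (hF : ∀ γ : SL(2, ℤ), γ ∈ Gamma0 N → ∀ B, F (γ * B) = F B) (s : SL(2, ℤ)) :
    ∑ q, F ((g q)⁻¹ * s) = ∑ q, F (g q)⁻¹ := by
  set a : ↥𝒮ℒ := ⟨Matrix.SpecialLinearGroup.mapGL ℝ s, HaberlandBoundary.mem_SL_range s⟩ with ha
  rw [← HaberlandBoundary.sum_smul_eq (F := fun q ↦ F (g q)⁻¹) a⁻¹]
  refine Finset.sum_congr rfl fun q _ ↦ ?_
  obtain ⟨γ₁, hγ₁, hrep⟩ := HaberlandBoundary.exists_rep_inv_smul g hg s q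
  simp only [ha] at hrep ⊢
  rw [hrep, hF γ₁ hγ₁]

include hg in
/-- **Haberland's formula for cusp forms on `Γ₀(N)`** (Paşol–Popa Thm. 3.2(a),
`6C_k(f,g) = ⟨⟨ρ_f|(T - T⁻¹), ρ̄_g⟩⟩`, `C_k = -(2i)^{k-1}`), in the tree's normalisation and moment
coordinates: for even `n`, `f, g ∈ S_{n+2}(Γ₀(N))` and coset representatives `g_q`,
`6 (2i)ⁿ⁺¹ · peterssonProduct Γ₀(N) (n+2) g f
   = ∑_q invForm (σ_T μ_f(g_q⁻¹T) - σ_T' μ_f(g_q⁻¹T⁻¹)) (\overline{μ_g(g_q⁻¹)})`. [cite: PasolPopa2013, Thm. 3.2(a)] -/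
theorem six_mul_petersson_eq_sum_invForm (hn : Even n)
    [Fintype (↥𝒮ℒ ⧸ (Gamma0 N : Subgroup (GL (Fin 2) ℝ)).subgroupOf 𝒮ℒ)] (f G : CuspForm (Gamma0 N) (n + 2)) :
    6 * (2 * I) ^ (n + 1) * peterssonProduct (Gamma0 N) (n + 2) G f =
      ∑ q, invForm n ((twistP n).mulVec (fun j ↦ msymbMoment n ((g q)⁻¹ * T) j f) -
          (twistPinv n).mulVec (fun j ↦ msymbMoment n ((g q)⁻¹ * T⁻¹) j f))
        (fun j ↦ conj (msymbMoment n (g q)⁻¹ j G)) := by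
  have h3 := HaberlandBoundary.two_mul_petersson_eq_sum_invForm g hg hn f G
  have halg := haberland_algebra hn (fun q ↦ (g q)⁻¹) (sum_rep_inv_mul g hg) f G
  rw [← halg]
  simp only [momVec]
  rw [← h3]
  ring

include hg in
omit [NeZero N] in
/-- The bijection `q ↦ g_q Γ₀(N)` between the two models `𝒮ℒ/Γ₀(N)` and `SL₂(ℤ)/Γ₀(N)` of the
coset space. [folklore] -/
theorem bijective_mk_rep :
    Function.Bijective (fun q : ↥𝒮ℒ ⧸ (Gamma0 N : Subgroup (GL (Fin 2) ℝ)).subgroupOf 𝒮ℒ ↦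
      ((g q : SL(2, ℤ)) : Gamma0Coset N)) := by
  constructor
  · intro q r hqr
    have h : (g q)⁻¹ * g r ∈ Gamma0 N := QuotientGroup.eq.mp hqr
    exact (coset_eq_iff g hg q r).mpr h
  · intro x
    induction x using QuotientGroup.induction_on with
    | H h =>
      refine ⟨QuotientGroup.mk (⟨Matrix.SpecialLinearGroup.mapGL ℝ h, h, rfl⟩ : ↥𝒮ℒ), ?_⟩
      exact QuotientGroup.eq.mpr (inv_mul_mem_Gamma0_of_mk g hg h)

include hg in
/-- **Haberland's formula indexed by the cosets `x ∈ SL₂(ℤ)/Γ₀(N)`** with the tree's M-symbol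
vectors `R_f(x)ⱼ = msymbK n x j f` (so `R_f(hΓ₀(N)) = μ_f(h⁻¹)`): for even `n` and
`f, g ∈ S_{n+2}(Γ₀(N))`,
`6 (2i)ⁿ⁺¹ · peterssonProduct Γ₀(N) (n+2) g f = ∑_x invForm (σ_T R_f(T⁻¹x) - σ_T' R_f(Tx)) (\overline{R_g(x)})`
(Paşol–Popa Thm. 3.2(a) `6C_k(f,g) = ⟨⟨ρ_f|(T-T⁻¹), ρ̄_g⟩⟩` in the induced-module picture
`(P|γ)(A) = P(Aγ⁻¹)|γ` on left cosets). [cite: PasolPopa2013, Thm. 3.2(a)] -/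
theorem six_mul_petersson_eq_sum_coset (hn : Even n) (f G : CuspForm (Gamma0 N) (n + 2)) :
    6 * (2 * I) ^ (n + 1) * peterssonProduct (Gamma0 N) (n + 2) G f =
      ∑ x : Gamma0Coset N, invForm n
        ((twistP n).mulVec (fun j ↦ msymbK n (T⁻¹ • x) j f) - (twistPinv n).mulVec (fun j ↦ msymbK n (T • x) j f))
        (fun j ↦ conj (msymbK n x j G)) := by
  letI : Fintype (↥𝒮ℒ ⧸ (Gamma0 N : Subgroup (GL (Fin 2) ℝ)).subgroupOf 𝒮ℒ) := Fintype.ofFinite _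
  rw [six_mul_petersson_eq_sum_invForm g hg hn f G]
  refine Fintype.sum_bijective _ (bijective_mk_rep g hg) _ _ fun q ↦ ?_
  simp only [MulAction.Quotient.smul_mk, smul_eq_mul, msymbK_mk, mul_inv_rev, inv_inv]

end Formula


end HaberlandAlgebra

end Literature.NumberTheory.EllipticCurves.ModularForms
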